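import Literature.AlgebraicGeometry.HodgeTheory.AbelianVarietyCyclotomicAutomorphismCrossedProductIsotypicImages
import Literature.AlgebraicGeometry.HodgeTheory.AbelianVarietyCyclotomicAutomorphismDoubleReflexHodgeConjecture
import Literature.AlgebraicGeometry.Pohlmann1968.SimpleCMAbelianVarietyHazamaCriterion
import HarnessLib

/-!
# The crossed product `End⁰(A)`, XVIII — THE HODGE CONJECTURE FOR THE KANI–ROSEN FACTORS `u(A)` OF A CYCLOTOMIC PAIR:
# every image `u(A)` of an integral quasi-idempotent `u² = a u` of a pair `(A, δ)` (`Φ_m(δ) = 0`, `φ(m) = 2 dim A`) is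
# isogenous to a power `C^{s(u)}` of the simple CM factor `C` of `A ∼ C^{#H′}` (`dim C = #S / #H′`), hence `B = D` and the
# Hodge conjecture hold for `u(A)` AND ALL ITS POWERS whenever `#S / #H′` is prime or `≤ 3` — in particular for every
# `u(A) ⊂ A` when `dim A` is prime or `≤ 3` (GEN 49 row 8)

Layer `Literature/AlgebraicGeometry/HodgeTheory`; theorems only (no `def`, no named fact; net debt 0).  Sequel of GEN 49 rows
6–7 (`…CrossedProductIsotypicCriterion` ∕ `…IsotypicImages`: `X ∼ C^{n+1}` ⟹ `u(X) ∼ C^{s}`) and of GEN 45 row 2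
(`…DoubleReflexHodgeConjecture`: `A ∼ C^{#H′}` with `C` SIMPLE of CM type, `dim C · #H′ = dim A = #S`; `B = D` and the Hodge
conjecture for the powers `A^{N+1}` when `#S / #H′` is prime (Tankeev–Ribet) or `≤ 3` (Ribet (3.7))).  Here the same is obtained
for every abelian subvariety `u(A)` cut out by an integral quasi-idempotent — the Kani–Rosen factors: images of norm endomorphisms
of subgroups of `H′`, of the integral matrix units `F_{ii}` of GEN 49 row 2, of the idempotents `y ∈ End⁰(A) ≅ M_h(K′)`.

THE PRINT.  [Gordon1999HodgeAVSurvey] Thm. 6.3, Corollary and Remark (Tankeev–Ribet: a simple abelian variety of CM type and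
PRIME dimension has `B(A^n) = D(A^n)` for all `n`); [Ribet1980] §3 Examples (3.7) (simple CM of dimension `≤ 3` is
nondegenerate); [vanGeemen1994HodgeAV] §2.4–2.5, §3.6 («if `Dᵖ = Bᵖ`, then the Hodge `(p,p)`-conjecture is true», `B = D` is an
isogeny invariant).  [Shimura1998] §5.1 Prop. 3 (chunk p0048 L1): «`A` is isogenous to a product `B × ⋯ × B` with a simple
abelian variety `B`»; Prop. 4 (L13): «`2n = fgh`, `2m = fg`».  [Lange2023AbelianVarietiesComplex] §2.4.4 Thm. 2.4.25 (PDF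
p. 123): «This decomposition is unique up to isogenies and permutations» (so every `u(A) ⊂ A ∼ B^h` is `∼ B^s`).
[KaniRosen1989] Thm. A: idempotent relations in `End⁰` give isogeny relations among the `ε(A)`.

THE ARGUMENT.  GEN 45: `A = A^{0+1} ∼ C^{#H′}` with `C` simple, `IsOfCMType C`, `dim C · #H′ = dim A`.  Row 6: `u(A) ∼ ⨁_{Fin s} C`
(`u² = a u`, `a ≠ 0`; `s ≥ 1` iff `dim u(A) > 0`).  Powers: `u(A)^{N+1} ∼ (⨁_{Fin s} C)^{N+1} ∼ ⨁_{Fin (N+1)} ⨁_{Fin s} C ∼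
⨁_{Fin (N+1)s} C ∼ C^{(N+1)s}` (the tree's `isIsogenous_powSucc`, `isIsogenous_powSucc_biproduct`, GEN 45's flattening).  Then
the tree's `Pohlmann1968.isDivisorGenerated_of_isIsogenous_powSucc_of_isSimple_of_isOfCMType_of_prime` (`dim C` prime) and
`isDivisorGenerated_powSucc_of_isSimple_of_isOfCMType_of_dim_le_three` (`dim C ≤ 3`) with the isogeny invariance of `B = D`,
and `hodgeConjectureFor_of_isDivisorGenerated`.  `dim C = #S / #H′`; for `dim A = #S` prime, `#H′ ∈ {1, dim A}` gives
`dim C ∈ {dim A, 1}`.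

WHAT THIS FILE PROVES (pair `(A, δ)` over `ℂ`, `Φ_m(δ) = 0`, `φ(m) = 2 dim A`, `S = cmTypeOf A δ m`, `H′ = Stab(S)`; `u² = a u`,
`a ≠ 0`; v2: the hypothesis `0 < dim u(A)` of v1's §2–§3 is dropped — for `dim u(A) = 0` every power `u(A)^{N+1}` is
zero-dimensional and `B = D` there by the tree's `isDivisorGenerated_of_dim_eq_zero`; §1 keeps it, its conclusion being false
for `u(A) = 0`).
* §1 `exists_isSimple_isOfCMType_isIsogenous_biproduct_const` (`A ∼ ⨁_{Fin (n+1)} C`, `C` simple of CM type, `n + 1 = #H′`,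
  `dim C · #H′ = dim A`), **`exists_isSimple_isOfCMType_powSucc_image_isIsogenous_powSucc`** (`u(A)^{N+1} ∼ C^{k+1}` for every
  `N`, some `k`, with that `C`).
* §2 **`isDivisorGenerated_powSucc_image_of_card_div_prime`**, **`hodgeConjectureFor_powSucc_image_of_card_div_prime`**,
  `hodgeConjectureFor_image_of_card_div_prime` (`#S / #H′` prime), **`isDivisorGenerated_powSucc_image_of_card_div_le_three`**,
  **`hodgeConjectureFor_powSucc_image_of_card_div_le_three`**, `hodgeConjectureFor_image_of_card_div_le_three` (`#S / #H′ ≤ 3`).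
* §3 (no hypothesis on `S`): **`hodgeConjectureFor_powSucc_image_of_prime_dim`** (`dim A` prime),
  **`hodgeConjectureFor_powSucc_image_of_dim_le_three`** (`dim A ≤ 3`) — the Hodge conjecture for every Kani–Rosen factor
  `u(A)` of such a pair and all its powers.

## References

* [Gordon1999HodgeAVSurvey] B. B. Gordon, *A survey of the Hodge conjecture for abelian varieties* (1999), Thm. 6.3 with
  Corollary and Remark, §9.3.
* [Ribet1980] K. A. Ribet, *Division fields of abelian varieties with complex multiplication* (1980), §3 Examples (3.7).
* [vanGeemen1994HodgeAV] B. van Geemen, *An introduction to the Hodge conjecture for abelian varieties* (1994), §2.4–2.5, §3.6.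
* [Shimura1998] G. Shimura, *Abelian Varieties with Complex Multiplication and Modular Functions* (1998), §5.1 Props. 3–4
  (chunk p0048 L1–L13), §8.2 Prop. 26 (chunk p0081 L3–L9).
* [Lange2023AbelianVarietiesComplex] H. Lange, *Abelian Varieties over the Complex Numbers* (2023), §2.4.4 Thm. 2.4.25,
  Cor. 2.4.26 (PDF pp. 123–124).
* [KaniRosen1989] E. Kani, M. Rosen, *Idempotent relations and factors of Jacobians*, Math. Ann. 284 (1989), Thm. A.
-/

noncomputable section

open Module NumberField CategoryTheory CategoryTheory.Limits Polynomial
open scoped Pointwise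

namespace Literature.AlgebraicGeometry.HodgeTheory

namespace AbelianVariety

open Literature.NumberTheory.ComplexMultiplication
open Literature.AlgebraicGeometry.Motives (CMType)
open Literature.AlgebraicGeometry.Motives Literature.AlgebraicGeometry.Motives.AbelianVariety
open Literature.AlgebraicGeometry.Milne1999 (IsOfCMType)
open Literature.AlgebraicGeometry.Pohlmann1968 (isIsogenous_powSucc_biproduct isIsogenous_powSucc
  isDivisorGenerated_of_isIsogenous_powSucc_of_isSimple_of_isOfCMType_of_prime
  isDivisorGenerated_powSucc_of_isSimple_of_isOfCMType_of_dim_le_three)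

variable {m : ℕ} [NeZero m] {A : Motives.AbelianVariety ℂ} {δ : A ⟶ A} {S : Finset (ZMod m)}

/-! ## §1 `u(A)^{N+1}` is isogenous to a power of the simple CM factor `C` -/

/-- **`A ∼ ⨁_{Fin (n+1)} C` with `C` SIMPLE OF CM TYPE, `n + 1 = #H′`, `dim C · #H′ = dim A`, `0 < dim C`** — GEN 45's
`exists_isSimple_powSucc_isIsogenous_powSucc` at `N = 0` (`A^{1} ∼ C^{#H′}`) in biproduct form («`A` is isogenous to a product
`B × ⋯ × B` with a simple abelian variety `B`», «`2n = fgh`»).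
[cite: Shimura1998, §5.1 Props. 3–4 (chunk p0048 L1–L13), §8.2 Prop. 26 (chunk p0081 L3–L9)] [cite: Lange2023AbelianVarietiesComplex, §2.4.4 Thm. 2.4.25 (PDF p. 123)] -/
theorem exists_isSimple_isOfCMType_isIsogenous_biproduct_const
    (hδ : (cyclotomic m ℤ).eval₂ (Int.castRingHom (End A)) (End.of δ) = 0) (hg : Nat.totient m = 2 * A.dim)
    (hS : cmTypeOf A δ m = ↑S) :
    ∃ (C : Motives.AbelianVariety ℂ) (n : ℕ), C.IsSimple ∧ IsOfCMType C ∧ 0 < C.dim ∧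
      C.dim * Nat.card (MulAction.stabilizer (ZMod m)ˣ (↑S : Set (ZMod m))) = A.dim ∧
      n + 1 = Nat.card (MulAction.stabilizer (ZMod m)ˣ (↑S : Set (ZMod m))) ∧
      IsIsogenous A (⨁ fun _ : Fin (n + 1) ↦ C) := by
  obtain ⟨C, hs, hcm, hdim, hiso⟩ := exists_isSimple_powSucc_isIsogenous_powSucc hδ hg hS
  have hcard : 0 < Nat.card (MulAction.stabilizer (ZMod m)ˣ (↑S : Set (ZMod m))) := Nat.card_pos
  have hA : 0 < A.dim := by
    have h := Nat.totient_pos.2 (NeZero.pos m)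
    rw [hg] at h
    omega
  have hC0 : 0 < C.dim := Nat.pos_of_ne_zero fun h ↦ by
    rw [h, zero_mul] at hdim
    omega
  refine ⟨C, Nat.card (MulAction.stabilizer (ZMod m)ˣ (↑S : Set (ZMod m))) - 1, hs, hcm, hC0, hdim, by omega, ?_⟩
  have h := hiso 0 (Nat.card (MulAction.stabilizer (ZMod m)ˣ (↑S : Set (ZMod m))) - 1) (by omega)
  rw [powSucc_zero] at h
  exact h.trans (isIsogenous_powSucc_biproduct C _)

/-- **`u(A)^{N+1} ∼ C^{k+1}`** for every `N` (some `k`, namely `k + 1 = (N+1)·s(u)`), for every integral quasi-idempotent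
`u² = a u`, `a ≠ 0` with `0 < dim u(A)`, with the simple CM factor `C` of §1: `u(A) ∼ ⨁_{Fin s} C` (GEN 49 row 6) and powers
∕ flattening of biproducts up to isogeny. [cite: Lange2023AbelianVarietiesComplex, §2.4.4 Thm. 2.4.25 (PDF p. 123)] [cite: KaniRosen1989, Thm. A] [cite: Shimura1998, §5.1 Prop. 3 (chunk p0048 L1)] -/
theorem exists_isSimple_isOfCMType_powSucc_image_isIsogenous_powSucc
    (hδ : (cyclotomic m ℤ).eval₂ (Int.castRingHom (End A)) (End.of δ) = 0) (hg : Nat.totient m = 2 * A.dim)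
    (hS : cmTypeOf A δ m = ↑S) {u : A ⟶ A} {a : ℕ} (hu : u ≫ u = a • u) (ha : a ≠ 0)
    (h0 : 0 < (Motives.AbelianVariety.image u).dim) :
    ∃ C : Motives.AbelianVariety ℂ, C.IsSimple ∧ IsOfCMType C ∧ 0 < C.dim ∧
      C.dim * Nat.card (MulAction.stabilizer (ZMod m)ˣ (↑S : Set (ZMod m))) = A.dim ∧
      ∀ N : ℕ, ∃ k : ℕ, IsIsogenous ((Motives.AbelianVariety.image u).powSucc N) (C.powSucc k) := by
  classical
  obtain ⟨C, n, hs, hcm, hC0, hdim, -, hX⟩ := exists_isSimple_isOfCMType_isIsogenous_biproduct_const hδ hg hS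
  obtain ⟨s, hsU⟩ := exists_isIsogenous_image_biproduct_const hs hC0 hX hu ha
  have hs0 : 0 < s := Nat.pos_of_ne_zero fun h ↦ by
    have hd := dim_image_eq_mul_of_isIsogenous hsU
    rw [h, zero_mul] at hd
    omega
  refine ⟨C, hs, hcm, hC0, hdim, fun N ↦ ⟨(N + 1) * s - 1, ?_⟩⟩
  have hk : (N + 1) * s - 1 + 1 = (N + 1) * s :=
    Nat.sub_add_cancel (Nat.one_le_iff_ne_zero.2 (Nat.mul_ne_zero (Nat.succ_ne_zero N) hs0.ne'))
  exact ((isIsogenous_powSucc hsU N).trans ((isIsogenous_powSucc_biproduct _ N).trans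
    (isIsogenous_biproduct_biproduct_const hk C))).trans (isIsogenous_powSucc_biproduct C _).symm'

/-- `dim X = 0 ⟹ B = D` on every power `X^{N+1}` (`dim X^{N+1} = (N+1) · 0 = 0`; the degenerate case of the rows below,
through the tree's `isDivisorGenerated_of_dim_eq_zero`). [folklore] -/
private theorem isDivisorGenerated_powSucc_of_dim_eq_zero (X : Motives.AbelianVariety ℂ) (hX : X.dim = 0) (N : ℕ) :
    IsDivisorGenerated (X.powSucc N) := by
  have hd : (X.powSucc N).dim = 0 := by
    rw [(isIsogenous_powSucc_biproduct X N).dim_eq, dim_biproduct_const, hX, mul_zero]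
  exact Literature.AlgebraicGeometry.Pohlmann1968.isDivisorGenerated_of_dim_eq_zero _ hd

/-! ## §2 `B = D` and the Hodge conjecture for `u(A)^{N+1}` when `#S / #H′` is prime or `≤ 3` -/

/-- **`B(u(A)^{N+1}) = D(u(A)^{N+1})` WHEN `#S / #H′` IS PRIME** — every image of an integral quasi-idempotent of the pair,
every power (Tankeev–Ribet for the simple CM factor `C` of prime dimension `#S / #H′`, isogeny invariance of
`B = D`). [cite: Gordon1999HodgeAVSurvey, Thm. 6.3, Corollary and Remark] [cite: vanGeemen1994HodgeAV, §2.4–2.5 and §3.6] [cite: Shimura1998, §5.1 Props. 3–4 (chunk p0048 L1–L13)] -/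
theorem isDivisorGenerated_powSucc_image_of_card_div_prime
    (hδ : (cyclotomic m ℤ).eval₂ (Int.castRingHom (End A)) (End.of δ) = 0) (hg : Nat.totient m = 2 * A.dim)
    (hS : cmTypeOf A δ m = ↑S) (hp : (S.card / Nat.card (MulAction.stabilizer (ZMod m)ˣ (↑S : Set (ZMod m)))).Prime)
    {u : A ⟶ A} {a : ℕ} (hu : u ≫ u = a • u) (ha : a ≠ 0) (N : ℕ) :
    IsDivisorGenerated ((Motives.AbelianVariety.image u).powSucc N) := by
  rcases Nat.eq_zero_or_pos (Motives.AbelianVariety.image u).dim with h0 | h0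
  · exact isDivisorGenerated_powSucc_of_dim_eq_zero _ h0 N
  obtain ⟨C, hs, hcm, -, hdim, hiso⟩ := exists_isSimple_isOfCMType_powSucc_image_isIsogenous_powSucc hδ hg hS hu ha h0
  obtain ⟨k, hk⟩ := hiso N
  exact isDivisorGenerated_of_isIsogenous_powSucc_of_isSimple_of_isOfCMType_of_prime hp
    (dim_doubleReflex_eq_card_div hδ hg hS hdim) hs hcm hk

/-- **THE HODGE CONJECTURE FOR `u(A)^{N+1}` WHEN `#S / #H′` IS PRIME**, unconditional. [cite: Gordon1999HodgeAVSurvey, Thm. 6.3, Corollary and Remark] [cite: vanGeemen1994HodgeAV, §2.4] -/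
theorem hodgeConjectureFor_powSucc_image_of_card_div_prime
    (hδ : (cyclotomic m ℤ).eval₂ (Int.castRingHom (End A)) (End.of δ) = 0) (hg : Nat.totient m = 2 * A.dim)
    (hS : cmTypeOf A δ m = ↑S) (hp : (S.card / Nat.card (MulAction.stabilizer (ZMod m)ˣ (↑S : Set (ZMod m)))).Prime)
    {u : A ⟶ A} {a : ℕ} (hu : u ≫ u = a • u) (ha : a ≠ 0) (N : ℕ) :
    HodgeConjectureFor ((Motives.AbelianVariety.image u).powSucc N).dim ((Motives.AbelianVariety.image u).powSucc N).X :=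
  hodgeConjectureFor_of_isDivisorGenerated _ (isDivisorGenerated_powSucc_image_of_card_div_prime hδ hg hS hp hu ha N)

/-- The case `N = 0`: **the Hodge conjecture for `u(A)` itself when `#S / #H′` is prime**. [cite: Gordon1999HodgeAVSurvey, Thm. 6.3, Corollary and Remark] -/
theorem hodgeConjectureFor_image_of_card_div_prime
    (hδ : (cyclotomic m ℤ).eval₂ (Int.castRingHom (End A)) (End.of δ) = 0) (hg : Nat.totient m = 2 * A.dim)
    (hS : cmTypeOf A δ m = ↑S) (hp : (S.card / Nat.card (MulAction.stabilizer (ZMod m)ˣ (↑S : Set (ZMod m)))).Prime)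
    {u : A ⟶ A} {a : ℕ} (hu : u ≫ u = a • u) (ha : a ≠ 0) :
    HodgeConjectureFor (Motives.AbelianVariety.image u).dim (Motives.AbelianVariety.image u).X :=
  hodgeConjectureFor_powSucc_image_of_card_div_prime hδ hg hS hp hu ha 0

/-- **`B(u(A)^{N+1}) = D(u(A)^{N+1})` WHEN `#S / #H′ ≤ 3`** (Ribet (3.7): the simple CM factor `C` of dimension `#S / #H′ ≤ 3` is
nondegenerate). [cite: Ribet1980, §3 Examples (3.7)] [cite: Gordon1999HodgeAVSurvey, §9.3] [cite: vanGeemen1994HodgeAV, §2.4–2.5 and §3.6] -/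
theorem isDivisorGenerated_powSucc_image_of_card_div_le_three
    (hδ : (cyclotomic m ℤ).eval₂ (Int.castRingHom (End A)) (End.of δ) = 0) (hg : Nat.totient m = 2 * A.dim)
    (hS : cmTypeOf A δ m = ↑S) (h3 : S.card / Nat.card (MulAction.stabilizer (ZMod m)ˣ (↑S : Set (ZMod m))) ≤ 3)
    {u : A ⟶ A} {a : ℕ} (hu : u ≫ u = a • u) (ha : a ≠ 0) (N : ℕ) :
    IsDivisorGenerated ((Motives.AbelianVariety.image u).powSucc N) := by
  rcases Nat.eq_zero_or_pos (Motives.AbelianVariety.image u).dim with h0 | h0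
  · exact isDivisorGenerated_powSucc_of_dim_eq_zero _ h0 N
  obtain ⟨C, hs, hcm, hC0, hdim, hiso⟩ := exists_isSimple_isOfCMType_powSucc_image_isIsogenous_powSucc hδ hg hS hu ha h0
  obtain ⟨k, hk⟩ := hiso N
  have hd := dim_doubleReflex_eq_card_div hδ hg hS hdim
  exact (isDivisorGenerated_powSucc_of_isSimple_of_isOfCMType_of_dim_le_three C hs hC0 (hd ▸ h3) hcm k).of_isIsogenous hk

/-- **THE HODGE CONJECTURE FOR `u(A)^{N+1}` WHEN `#S / #H′ ≤ 3`**, unconditional. [cite: Ribet1980, §3 Examples (3.7)] [cite: Gordon1999HodgeAVSurvey, §9.3] -/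
theorem hodgeConjectureFor_powSucc_image_of_card_div_le_three
    (hδ : (cyclotomic m ℤ).eval₂ (Int.castRingHom (End A)) (End.of δ) = 0) (hg : Nat.totient m = 2 * A.dim)
    (hS : cmTypeOf A δ m = ↑S) (h3 : S.card / Nat.card (MulAction.stabilizer (ZMod m)ˣ (↑S : Set (ZMod m))) ≤ 3)
    {u : A ⟶ A} {a : ℕ} (hu : u ≫ u = a • u) (ha : a ≠ 0) (N : ℕ) :
    HodgeConjectureFor ((Motives.AbelianVariety.image u).powSucc N).dim ((Motives.AbelianVariety.image u).powSucc N).X :=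
  hodgeConjectureFor_of_isDivisorGenerated _ (isDivisorGenerated_powSucc_image_of_card_div_le_three hδ hg hS h3 hu ha N)

/-- The case `N = 0`: **the Hodge conjecture for `u(A)` itself when `#S / #H′ ≤ 3`**. [cite: Ribet1980, §3 Examples (3.7)] [cite: Gordon1999HodgeAVSurvey, §9.3] -/
theorem hodgeConjectureFor_image_of_card_div_le_three
    (hδ : (cyclotomic m ℤ).eval₂ (Int.castRingHom (End A)) (End.of δ) = 0) (hg : Nat.totient m = 2 * A.dim)
    (hS : cmTypeOf A δ m = ↑S) (h3 : S.card / Nat.card (MulAction.stabilizer (ZMod m)ˣ (↑S : Set (ZMod m))) ≤ 3)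
    {u : A ⟶ A} {a : ℕ} (hu : u ≫ u = a • u) (ha : a ≠ 0) :
    HodgeConjectureFor (Motives.AbelianVariety.image u).dim (Motives.AbelianVariety.image u).X :=
  hodgeConjectureFor_powSucc_image_of_card_div_le_three hδ hg hS h3 hu ha 0

/-! ## §3 Pairs of prime dimension or of dimension `≤ 3`: every `u(A)`, no hypothesis on `S` -/

/-- **`B = D` FOR EVERY POWER OF EVERY KANI–ROSEN FACTOR `u(A)` OF A PAIR OF PRIME DIMENSION** (`#H′ ∣ #S = dim A` prime:
`#H′ = 1`, `C = A` of prime dimension, or `#H′ = dim A`, `C` a CM elliptic curve).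
[cite: Gordon1999HodgeAVSurvey, Thm. 6.3 with Corollary and Remark, §9.3] [cite: Shimura1998, §5.1 Prop. 3 (chunk p0048 L1), §8.2 Prop. 26 (chunk p0081 L3–L9)] -/
theorem isDivisorGenerated_powSucc_image_of_prime_dim
    (hδ : (cyclotomic m ℤ).eval₂ (Int.castRingHom (End A)) (End.of δ) = 0) (hg : Nat.totient m = 2 * A.dim)
    (hp : A.dim.Prime) {u : A ⟶ A} {a : ℕ} (hu : u ≫ u = a • u) (ha : a ≠ 0)
    (N : ℕ) : IsDivisorGenerated ((Motives.AbelianVariety.image u).powSucc N) := by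
  obtain ⟨S, hS, hScm, hcard⟩ := exists_isCMTypeSet_cmTypeOf_eq hδ hg
  have hm2 : 2 < m := two_lt_of_totient_eq_two_mul_dim (Nat.pos_of_ne_zero (NeZero.ne m)) hδ hg
  have hdvd := card_stabilizer_dvd_card hm2 hScm
  rw [hcard] at hdvd
  rcases (Nat.dvd_prime hp).1 hdvd with h1 | hA
  · exact isDivisorGenerated_powSucc_image_of_card_div_prime hδ hg hS (by rwa [h1, Nat.div_one, hcard]) hu ha N
  · exact isDivisorGenerated_powSucc_image_of_card_div_le_three hδ hg hS
      (by rw [hA, hcard, Nat.div_self hp.pos]; norm_num) hu ha N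

/-- **THE HODGE CONJECTURE FOR EVERY KANI–ROSEN FACTOR `u(A)` OF A PAIR `(A, δ)` OF PRIME DIMENSION AND ALL ITS POWERS**
(`Φ_m(δ) = 0`, `φ(m) = 2 dim A`; `u² = a u` integral, `a ≠ 0`), unconditional.
[cite: Gordon1999HodgeAVSurvey, Thm. 6.3 with Corollary and Remark, Thm. 6.4] [cite: KaniRosen1989, Thm. A] -/
theorem hodgeConjectureFor_powSucc_image_of_prime_dim
    (hδ : (cyclotomic m ℤ).eval₂ (Int.castRingHom (End A)) (End.of δ) = 0) (hg : Nat.totient m = 2 * A.dim)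
    (hp : A.dim.Prime) {u : A ⟶ A} {a : ℕ} (hu : u ≫ u = a • u) (ha : a ≠ 0)
    (N : ℕ) :
    HodgeConjectureFor ((Motives.AbelianVariety.image u).powSucc N).dim ((Motives.AbelianVariety.image u).powSucc N).X :=
  hodgeConjectureFor_of_isDivisorGenerated _ (isDivisorGenerated_powSucc_image_of_prime_dim hδ hg hp hu ha N)

/-- **`B = D` for every power of every `u(A)` of a pair of dimension `≤ 3`** (`#S / #H′ ≤ #S = dim A ≤ 3`).
[cite: Ribet1980, §3 Examples (3.7)] [cite: Gordon1999HodgeAVSurvey, §9.3] -/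
theorem isDivisorGenerated_powSucc_image_of_dim_le_three
    (hδ : (cyclotomic m ℤ).eval₂ (Int.castRingHom (End A)) (End.of δ) = 0) (hg : Nat.totient m = 2 * A.dim)
    (h3 : A.dim ≤ 3) {u : A ⟶ A} {a : ℕ} (hu : u ≫ u = a • u) (ha : a ≠ 0)
    (N : ℕ) : IsDivisorGenerated ((Motives.AbelianVariety.image u).powSucc N) := by
  obtain ⟨S, hS, -, hcard⟩ := exists_isCMTypeSet_cmTypeOf_eq hδ hg
  exact isDivisorGenerated_powSucc_image_of_card_div_le_three hδ hg hS ((Nat.div_le_self _ _).trans (hcard ▸ h3)) hu ha N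

/-- **THE HODGE CONJECTURE FOR EVERY `u(A)` OF A PAIR `(A, δ)` OF DIMENSION `≤ 3` AND ALL ITS POWERS**, unconditional.
[cite: Ribet1980, §3 Examples (3.7)] [cite: Gordon1999HodgeAVSurvey, §9.3] [cite: KaniRosen1989, Thm. A] -/
theorem hodgeConjectureFor_powSucc_image_of_dim_le_three
    (hδ : (cyclotomic m ℤ).eval₂ (Int.castRingHom (End A)) (End.of δ) = 0) (hg : Nat.totient m = 2 * A.dim)
    (h3 : A.dim ≤ 3) {u : A ⟶ A} {a : ℕ} (hu : u ≫ u = a • u) (ha : a ≠ 0)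
    (N : ℕ) :
    HodgeConjectureFor ((Motives.AbelianVariety.image u).powSucc N).dim ((Motives.AbelianVariety.image u).powSucc N).X :=
  hodgeConjectureFor_of_isDivisorGenerated _ (isDivisorGenerated_powSucc_image_of_dim_le_three hδ hg h3 hu ha N)

end AbelianVariety

end Literature.AlgebraicGeometry.HodgeTheory

end
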